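import Summits.QuantumFields.QCD.Theorems.PauliWegnerSeaChiralGluonicCompletionGlobalContinuum

/-!
# Offset-localised hereditary pin: the chirality stub of line `Sketch_ideator5_r2` (card anomaly-refutes-every-branch)
# for crux `stmt-QuantumFields-17498` `ChiralGluonicCompletion` — composition and calibration (sorry-free, def-free)

Line lead prover-line-stmt-QuantumFields-17498-c7-0 (line cycle 8, 2026-08-17).  Registered skeleton:
`Cruxes/ChiralGluonicCompletion/Lines/Sketch_ideator5_r2.lean` (namespace `Summit.QuantumFields.QCD.Theorems.AnomalyBranch`).

The line replaces the dead stub E* (`stub_hereditaryPin` of line `Sketch`: along SOME subsequence the pin `IsChiralAtZero`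
holds along EVERY further subsequence — certified not derivable from the shape of the crux's hypothesis, p142184 / p144745 /
p146141) by `stub_offsetCertificate`: an abstract BRANCH CERTIFICATE `W` (hereditary under reindexing, refuting the uniform
lattice gap) plus, for every gapped `Hyp`-witness, an OFFSET FUNCTION `M : ℕ → ℝ` locating `W` (every `M`-null branch has a
sub-branch carrying `W`), with massive cutoffs uniformly gapped (one rate for all positive tuples on `{k | μ ≤ M k}`) and no
eventually-negative offsets.  This file records, kernel-checked and over tree vocabulary only:

* §1 the selection logic (ideator 5): `exists_branch_tendsto_zero` (frequently small at every level ⇒ a null branch — level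
  sets of ONE real sequence are nested, the finite-intersection property the pin's violation family lacks) and
  `frequently_small_of_pin` (the typed `∃ᶠ` pin + uniformly gapped massive cutoffs + no eventually-negative offsets ⇒ `M`
  frequently small at every level);
* §2 `hereditaryPin_of_offsetCertificate`: certificate + offset ⇒ E* for any regularisation with the pin — so the new stub is
  AT LEAST AS STRONG as E* at the level of `Hyp`'s shape (the countermodels above apply to it a fortiori; its merit is the named
  supplier — Ward-triple data of route AnomalyRigidity, items 17716/17718 — not derivability);
* §3 `W`-ELIMINATION (`exists_certificate_located_iff`, `offsetCertificateAt_iff`): with `W` existential, reg by reg the stub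
  says exactly "every `M`-null branch has a HEREDITARILY CHIRAL sub-branch" for an admissible `M` — an offset-localised
  hereditary pin; the anomaly physics enters only once `W` is FIXED to typed Ward data;
* §4 the composition `chiralGluonicCompletion_of_offsetCertificate`: `stub_offsetCertificate` → C1 → C2' → crux (both route
  copies), through the landed `chiralGluonicCompletion_of_hereditaryPin_globalContinuum` (p139623).
-/

noncomputable section

open MeasureTheory Filter Topology
open Literature.MathematicalPhysics.QuantumFieldTheory Literature.MathematicalPhysics.QuantumLattice
  Literature.Probability.LatticeModels
open Summit.QuantumFields.QCD.Theorems.StronglyChiralSubsequence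

namespace Summit.QuantumFields.QCD.Theorems.AnomalyBranch

variable {Nf : ℕ}

/-! ## §1 Selection on one real sequence; the pin locates -/

/-- **Frequently small at every level ⇒ a branch along which the sequence tends to `0`** (the level sets
`{k | |M k| < 1/(j+1)}` are nested in `j`, so `Filter.extraction_forall_of_frequently` applies). -/
theorem exists_branch_tendsto_zero {M : ℕ → ℝ} (h : ∀ j : ℕ, ∃ᶠ k in atTop, |M k| < 1 / ((j : ℝ) + 1)) :
    ∃ φ : ℕ → ℕ, StrictMono φ ∧ Tendsto (M ∘ φ) atTop (𝓝 0) := by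
  obtain ⟨φ, hφ, hφM⟩ := extraction_forall_of_frequently h
  refine ⟨φ, hφ, ?_⟩
  rw [tendsto_zero_iff_abs_tendsto_zero]
  have h0 : Tendsto (fun _ : ℕ => (0 : ℝ)) atTop (𝓝 0) := tendsto_const_nhds
  have h1 : Tendsto (fun j : ℕ => 1 / ((j : ℝ) + 1)) atTop (𝓝 0) := tendsto_one_div_add_atTop_nhds_zero_nat
  exact tendsto_of_tendsto_of_tendsto_of_le_of_le h0 h1 (fun j => abs_nonneg _) fun j => le_of_lt (hφM j)

/-- **The pin locates.**  If the cutoffs with offset `≥ μ` are uniformly gapped (one rate `Δ(μ)` for all positive tuples,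
eventually, on all tori `S ≥ L_k`) and the offsets are eventually above every negative level, then the typed `∃ᶠ` pin
`reg.IsChiralAtZero` forces the offset function to be frequently small at every level: otherwise eventually `μ ≤ M k`, the
uniform gap `Δ(μ)` holds at EVERY positive tuple, and the pin at rate `Δ(μ)` is contradicted. -/
theorem frequently_small_of_pin (reg : QCDRegularisation Nf) (M : ℕ → ℝ) (hpin : reg.IsChiralAtZero)
    (hmass : ∀ μ > (0 : ℝ), ∃ Δ > (0 : ℝ), ∀ m : Fin Nf → ℝ, (∀ f, 0 < m f) →
      ∀ (R R' : ℕ) (A : QCDLatticeObservable Nf R) (B : QCDLatticeObservable Nf R'), ∃ C : ℝ,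
        ∀ᶠ k in atTop, μ ≤ M k → ∀ S : ℕ, reg.L k ≤ S → ∀ n : ℕ, n ≤ S →
          ‖qcdLatticeConnectedCorr (reg.β k) (2 * S + 1) (fun fl => (reg.scheme m 0 0).mq fl k) A B n‖ ≤
            C * Real.exp (-(Δ * (reg.a k * n))))
    (hneg : ∀ μ > (0 : ℝ), ∀ᶠ k in atTop, -μ < M k) :
    ∀ j : ℕ, ∃ᶠ k in atTop, |M k| < 1 / ((j : ℝ) + 1) := by
  intro j
  set μ : ℝ := 1 / ((j : ℝ) + 1) with hμ
  have hμpos : 0 < μ := by positivity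
  by_contra hcon
  rw [Filter.not_frequently] at hcon
  have hlarge : ∀ᶠ k in atTop, μ ≤ M k := by
    filter_upwards [hcon, hneg μ hμpos] with k hk hk'
    rw [not_lt] at hk
    by_contra hlt
    rw [not_le] at hlt
    exact absurd hk (not_le.2 (abs_lt.2 ⟨hk', hlt⟩))
  obtain ⟨Δ, hΔ, hgap⟩ := hmass μ hμpos
  obtain ⟨m, hm, hng⟩ := hpin Δ hΔ
  apply hng
  intro R R' A B
  obtain ⟨C, hC⟩ := hgap m hm R R' A B
  refine ⟨C, ?_⟩
  filter_upwards [hC, hlarge] with k hk hk' S hS n hn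
  exact hk hk' S hS n hn

/-! ## §2 Certificate + offset ⇒ E* -/

/-- **Certificate + offset ⇒ the hereditary pin (E*), abstractly.**  For ANY regularisation with the pin: a hereditary,
gap-refuting predicate `W`, an offset function locating `W`, uniformly gapped massive cutoffs and no eventually-negative
offsets give a branch along which the pin holds along every further sub-branch — verbatim the conclusion of the dead stub
`stub_hereditaryPin` of line `Sketch`.  Consequently the chirality stub of line `Sketch_ideator5_r2` is at least as strong as
E* over the crux's hypothesis, and E*'s non-derivability certificates (`pinShape_not_entails_hereditaryPin` p142184,
`pinThreshold_not_entails_hereditaryPin` p144745, `pinLipschitz_not_entails_hereditaryPin` p146141) apply to it a fortiori. -/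
theorem hereditaryPin_of_offsetCertificate (reg : QCDRegularisation Nf) (hpin : reg.IsChiralAtZero)
    (W : QCDRegularisation Nf → Prop)
    (hWh : ∀ (r : QCDRegularisation Nf) (ψ : ℕ → ℕ) (hψ : StrictMono ψ), W r → W (r.restrict ψ hψ.tendsto_atTop))
    (hWr : ∀ r : QCDRegularisation Nf, W r → r.IsChiralAtZero) (M : ℕ → ℝ)
    (hO : ∀ (φ : ℕ → ℕ) (hφ : StrictMono φ), Tendsto (M ∘ φ) atTop (𝓝 0) →
      ∃ ψ : ℕ → ℕ, ∃ hψ : StrictMono ψ, W ((reg.restrict φ hφ.tendsto_atTop).restrict ψ hψ.tendsto_atTop))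
    (hmass : ∀ μ > (0 : ℝ), ∃ Δ > (0 : ℝ), ∀ m : Fin Nf → ℝ, (∀ f, 0 < m f) →
      ∀ (R R' : ℕ) (A : QCDLatticeObservable Nf R) (B : QCDLatticeObservable Nf R'), ∃ C : ℝ,
        ∀ᶠ k in atTop, μ ≤ M k → ∀ S : ℕ, reg.L k ≤ S → ∀ n : ℕ, n ≤ S →
          ‖qcdLatticeConnectedCorr (reg.β k) (2 * S + 1) (fun fl => (reg.scheme m 0 0).mq fl k) A B n‖ ≤
            C * Real.exp (-(Δ * (reg.a k * n))))
    (hneg : ∀ μ > (0 : ℝ), ∀ᶠ k in atTop, -μ < M k) :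
    ∃ φ : ℕ → ℕ, ∃ hφ : StrictMono φ, ∀ (ψ : ℕ → ℕ) (hψ : StrictMono ψ),
      ((reg.restrict φ hφ.tendsto_atTop).restrict ψ hψ.tendsto_atTop).IsChiralAtZero := by
  obtain ⟨φ, hφ, hφ0⟩ := exists_branch_tendsto_zero (frequently_small_of_pin reg M hpin hmass hneg)
  obtain ⟨ψ, hψ, hW⟩ := hO φ hφ hφ0
  refine ⟨φ ∘ ψ, hφ.comp hψ, fun θ hθ => ?_⟩
  rw [← restrict_restrict reg φ hφ.tendsto_atTop ψ hψ.tendsto_atTop]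
  exact hWr _ (hWh _ θ hθ hW)

/-! ## §3 `W`-elimination: the stub, reg by reg, is an offset-localised hereditary pin -/

/-- Reindexing along `id` does not change chirality at zero (all data of `r.restrict id` are those of `r`, definitionally). -/
theorem isChiralAtZero_restrict_id (r : QCDRegularisation Nf) (h : Tendsto (id : ℕ → ℕ) atTop atTop) :
    (r.restrict id h).IsChiralAtZero ↔ r.IsChiralAtZero :=
  Iff.rfl

/-- **`W`-elimination.**  For a fixed regularisation and offset function: an abstract branch certificate (hereditary under
reindexing, refuting the uniform gap) located by `M` exists iff every `M`-null branch has a HEREDITARILY CHIRAL sub-branch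
(for `⇐` take `W r := ∀ θ, (r.restrict θ).IsChiralAtZero`, itself hereditary — `restrict_restrict` — and refuting — `θ = id`). -/
theorem exists_certificate_located_iff (reg : QCDRegularisation Nf) (M : ℕ → ℝ) :
    (∃ W : QCDRegularisation Nf → Prop,
      (∀ (r : QCDRegularisation Nf) (ψ : ℕ → ℕ) (hψ : StrictMono ψ), W r → W (r.restrict ψ hψ.tendsto_atTop)) ∧
      (∀ r : QCDRegularisation Nf, W r → r.IsChiralAtZero) ∧
      ∀ (φ : ℕ → ℕ) (hφ : StrictMono φ), Tendsto (M ∘ φ) atTop (𝓝 0) →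
        ∃ ψ : ℕ → ℕ, ∃ hψ : StrictMono ψ, W ((reg.restrict φ hφ.tendsto_atTop).restrict ψ hψ.tendsto_atTop)) ↔
    ∀ (φ : ℕ → ℕ) (hφ : StrictMono φ), Tendsto (M ∘ φ) atTop (𝓝 0) →
      ∃ ψ : ℕ → ℕ, ∃ hψ : StrictMono ψ, ∀ (θ : ℕ → ℕ) (hθ : StrictMono θ),
        (((reg.restrict φ hφ.tendsto_atTop).restrict ψ hψ.tendsto_atTop).restrict θ hθ.tendsto_atTop).IsChiralAtZero := by
  constructor
  · rintro ⟨W, hWh, hWr, hloc⟩ φ hφ hφ0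
    obtain ⟨ψ, hψ, hW⟩ := hloc φ hφ hφ0
    exact ⟨ψ, hψ, fun θ hθ => hWr _ (hWh _ θ hθ hW)⟩
  · intro h
    refine ⟨fun r => ∀ (θ : ℕ → ℕ) (hθ : StrictMono θ), (r.restrict θ hθ.tendsto_atTop).IsChiralAtZero,
      fun r ψ hψ hr θ hθ => ?_, fun r hr => ?_, fun φ hφ hφ0 => h φ hφ hφ0⟩
    · rw [restrict_restrict]
      exact hr (ψ ∘ θ) (hψ.comp hθ)
    · exact (isChiralAtZero_restrict_id r strictMono_id.tendsto_atTop).1 (hr id strictMono_id)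

/-- **The certificate stub at ONE regularisation is an offset-localised hereditary pin** (corollary of `W`-elimination):
`(∃ W hereditary ∧ refuting, ∃ M, located ∧ massive-gapped ∧ eventually-above-negative)` iff
`(∃ M, (every M-null branch has a hereditarily chiral sub-branch) ∧ massive-gapped ∧ eventually-above-negative)`. -/
theorem offsetCertificateAt_iff (reg : QCDRegularisation Nf) :
    (∃ W : QCDRegularisation Nf → Prop,
      (∀ (r : QCDRegularisation Nf) (ψ : ℕ → ℕ) (hψ : StrictMono ψ), W r → W (r.restrict ψ hψ.tendsto_atTop)) ∧
      (∀ r : QCDRegularisation Nf, W r → r.IsChiralAtZero) ∧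
      ∃ M : ℕ → ℝ,
        (∀ (φ : ℕ → ℕ) (hφ : StrictMono φ), Tendsto (M ∘ φ) atTop (𝓝 0) →
          ∃ ψ : ℕ → ℕ, ∃ hψ : StrictMono ψ, W ((reg.restrict φ hφ.tendsto_atTop).restrict ψ hψ.tendsto_atTop)) ∧
        (∀ μ > (0 : ℝ), ∃ Δ > (0 : ℝ), ∀ m : Fin Nf → ℝ, (∀ f, 0 < m f) →
          ∀ (R R' : ℕ) (A : QCDLatticeObservable Nf R) (B : QCDLatticeObservable Nf R'), ∃ C : ℝ,
            ∀ᶠ k in atTop, μ ≤ M k → ∀ S : ℕ, reg.L k ≤ S → ∀ n : ℕ, n ≤ S →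
              ‖qcdLatticeConnectedCorr (reg.β k) (2 * S + 1) (fun fl => (reg.scheme m 0 0).mq fl k) A B n‖ ≤
                C * Real.exp (-(Δ * (reg.a k * n)))) ∧
        (∀ μ > (0 : ℝ), ∀ᶠ k in atTop, -μ < M k)) ↔
    ∃ M : ℕ → ℝ,
      (∀ (φ : ℕ → ℕ) (hφ : StrictMono φ), Tendsto (M ∘ φ) atTop (𝓝 0) →
        ∃ ψ : ℕ → ℕ, ∃ hψ : StrictMono ψ, ∀ (θ : ℕ → ℕ) (hθ : StrictMono θ),
          (((reg.restrict φ hφ.tendsto_atTop).restrict ψ hψ.tendsto_atTop).restrict θ hθ.tendsto_atTop).IsChiralAtZero) ∧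
      (∀ μ > (0 : ℝ), ∃ Δ > (0 : ℝ), ∀ m : Fin Nf → ℝ, (∀ f, 0 < m f) →
        ∀ (R R' : ℕ) (A : QCDLatticeObservable Nf R) (B : QCDLatticeObservable Nf R'), ∃ C : ℝ,
          ∀ᶠ k in atTop, μ ≤ M k → ∀ S : ℕ, reg.L k ≤ S → ∀ n : ℕ, n ≤ S →
            ‖qcdLatticeConnectedCorr (reg.β k) (2 * S + 1) (fun fl => (reg.scheme m 0 0).mq fl k) A B n‖ ≤
              C * Real.exp (-(Δ * (reg.a k * n)))) ∧
      (∀ μ > (0 : ℝ), ∀ᶠ k in atTop, -μ < M k) := by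
  constructor
  · rintro ⟨W, hWh, hWr, M, hloc, hmass, hneg⟩
    exact ⟨M, (exists_certificate_located_iff reg M).1 ⟨W, hWh, hWr, hloc⟩, hmass, hneg⟩
  · rintro ⟨M, hloc, hmass, hneg⟩
    obtain ⟨W, hWh, hWr, hloc'⟩ := (exists_certificate_located_iff reg M).2 hloc
    exact ⟨W, hWh, hWr, M, hloc', hmass, hneg⟩

/-! ## §4 Composition: certificate stub → C1 → C2' → crux -/

/-- **The crux (PauliWegnerSea copy) from the chirality stub of line `Sketch_ideator5_r2`, C1 and C2'.**  The three
hypotheses are, verbatim, the registered stubs `stub_offsetCertificate`, the C1 node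
(`∀ m > 0, ∃ Δ > 0, HasLatticeMassGap` for every `Hyp`-witness — in the skeleton itself split further along card
norm-gap-cold-pressure) and `stub_continuum` (C2', global gap-conditioned); the proof locates an `M`-null branch
(`frequently_small_of_pin`, `exists_branch_tendsto_zero`), descends to a `W`-branch, reads off E* and applies the landed
`chiralGluonicCompletion_of_hereditaryPin_globalContinuum` (p139623). -/
theorem chiralGluonicCompletion_of_offsetCertificate : (∀ Nf : ℕ, Nf = 2 ∨ Nf = 3 → ∃ W : QCDRegularisation Nf → Prop, (∀ (r : QCDRegularisation Nf) (ψ : ℕ → ℕ) (hψ : StrictMono ψ), W r → W (r.restrict ψ hψ.tendsto_atTop)) ∧ (∀ r : QCDRegularisation Nf, W r → r.IsChiralAtZero) ∧ ∀ reg : QCDRegularisation Nf, Hyp Nf reg → (∀ m : Fin Nf → ℝ, (∀ f, 0 < m f) → ∃ Δ > 0, (reg.scheme m 0 0).HasLatticeMassGap Δ) → ∃ M : ℕ → ℝ, (∀ (φ : ℕ → ℕ) (hφ : StrictMono φ), Tendsto (M ∘ φ) atTop (𝓝 0) → ∃ ψ : ℕ → ℕ, ∃ hψ : StrictMono ψ,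 W ((reg.restrict φ hφ.tendsto_atTop).restrict ψ hψ.tendsto_atTop)) ∧ (∀ μ > (0 : ℝ), ∃ Δ > (0 : ℝ), ∀ m : Fin Nf → ℝ, (∀ f, 0 < m f) → ∀ (R R' : ℕ) (A : QCDLatticeObservable Nf R) (B : QCDLatticeObservable Nf R'), ∃ C : ℝ, ∀ᶠ k in atTop, μ ≤ M k → ∀ S : ℕ, reg.L k ≤ S → ∀ n : ℕ, n ≤ S → ‖qcdLatticeConnectedCorr (reg.β k) (2 * S + 1) (fun fl => (reg.scheme m 0 0).mq fl k) A B n‖ ≤ C * Real.exp (-(Δ * (reg.a k * n)))) ∧ (∀ μ > (0 : ℝ), ∀ᶠ k in atTop, -μ < M k)) → (∀ Nf : ℕ, Nf = 2 ∨ Nf = 3 → ∀ reg : QCDRegularisation Nf, Hyp Nf reg → ∀ m : Fin Nf → ℝ, (∀ f, 0 < m f) → ∃ Δ > 0, (reg.scheme m 0 0).HasLatticeMassGap Δ) → (∀ Nf : ℕ, Nf = 2 ∨ Nf = 3 → ∀ reg : QCDRegularisation Nf, Hyp Nf reg → (∀ m : Fin Nf → ℝ, (∀ f, 0 < m f) →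 ∃ Δ > 0, (reg.scheme m 0 0).HasLatticeMassGap Δ) → ∃ φ : ℕ → ℕ, ∃ hφ : StrictMono φ, ∀ m : Fin Nf → ℝ, (∀ f, 0 < m f) → ContinuumBody Nf (reg.restrict φ hφ.tendsto_atTop) m) → Summit.QuantumFields.QCD.Theses.PauliWegnerSea.ChiralGluonicCompletion := by
  intro hcert hC1 hC2
  refine chiralGluonicCompletion_of_hereditaryPin_globalContinuum ?_ hC1 hC2
  intro Nf hNf reg hH
  obtain ⟨W, hWh, hWr, hoff⟩ := hcert Nf hNf
  obtain ⟨M, hO, hmass, hneg⟩ := hoff reg hH (hC1 Nf hNf reg hH)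
  exact hereditaryPin_of_offsetCertificate reg hH.2.1 W hWh hWr M hO hmass hneg

/-- **The same composition for the WilsonMobilityGap copy of the crux** (the two route copies are one proposition,
`crux_eq_wilsonMobilityGap`). -/
theorem wilsonMobilityGap_chiralGluonicCompletion_of_offsetCertificate : (∀ Nf : ℕ, Nf = 2 ∨ Nf = 3 → ∃ W : QCDRegularisation Nf → Prop, (∀ (r : QCDRegularisation Nf) (ψ : ℕ → ℕ) (hψ : StrictMono ψ), W r → W (r.restrict ψ hψ.tendsto_atTop)) ∧ (∀ r : QCDRegularisation Nf, W r → r.IsChiralAtZero) ∧ ∀ reg : QCDRegularisation Nf, Hyp Nf reg → (∀ m : Fin Nf → ℝ, (∀ f, 0 < m f) → ∃ Δ > 0, (reg.scheme m 0 0).HasLatticeMassGap Δ) → ∃ M : ℕ → ℝ, (∀ (φ : ℕ → ℕ) (hφ : StrictMono φ), Tendsto (M ∘ φ) atTop (𝓝 0) → ∃ ψ : ℕ → ℕ, ∃ hψ : StrictMono ψ, W ((reg.restrict φ hφ.tendsto_atTop).restrict ψ hψ.tendsto_atTop)) ∧ (∀ μ > (0 : ℝ), ∃ Δ > (0 : ℝ),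 ∀ m : Fin Nf → ℝ, (∀ f, 0 < m f) → ∀ (R R' : ℕ) (A : QCDLatticeObservable Nf R) (B : QCDLatticeObservable Nf R'), ∃ C : ℝ, ∀ᶠ k in atTop, μ ≤ M k → ∀ S : ℕ, reg.L k ≤ S → ∀ n : ℕ, n ≤ S → ‖qcdLatticeConnectedCorr (reg.β k) (2 * S + 1) (fun fl => (reg.scheme m 0 0).mq fl k) A B n‖ ≤ C * Real.exp (-(Δ * (reg.a k * n)))) ∧ (∀ μ > (0 : ℝ), ∀ᶠ k in atTop, -μ < M k)) → (∀ Nf : ℕ, Nf = 2 ∨ Nf = 3 → ∀ reg : QCDRegularisation Nf, Hyp Nf reg → ∀ m : Fin Nf → ℝ, (∀ f, 0 < m f) → ∃ Δ > 0, (reg.scheme m 0 0).HasLatticeMassGap Δ) → (∀ Nf : ℕ, Nf = 2 ∨ Nf = 3 → ∀ reg : QCDRegularisation Nf, Hyp Nf reg → (∀ m : Fin Nf → ℝ, (∀ f, 0 < m f) → ∃ Δ > 0, (reg.scheme m 0 0).HasLatticeMassGap Δ) → ∃ φ : ℕ → ℕ, ∃ hφ : StrictMono φ, ∀ m : Fin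 Nf → ℝ, (∀ f, 0 < m f) → ContinuumBody Nf (reg.restrict φ hφ.tendsto_atTop) m) → Summit.QuantumFields.QCD.Theses.WilsonMobilityGap.ChiralGluonicCompletion :=
  chiralGluonicCompletion_of_offsetCertificate

end Summit.QuantumFields.QCD.Theorems.AnomalyBranch

end
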